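import Mathlib
import HarnessLib
import Summits.CriticalPhenomena.PercolationContinuityZ3.Theses.PercAxialLogConvexity

/-!
# Route `PercAxialLogConvexity`, item `KinkCriterion` (stmt-CriticalPhenomena-11551)

`KinkCriterion` is the percolation-free, real-analysis support item of the route: a sequence
`a : ℕ → ℝ` with `0 < θ ≤ a n ≤ 1`, log-convex (`a (n+1)^2 ≤ a n * a (n+2)`), cannot admit, for
every `M`, a scale `N ≥ M`, a constant `C` and a positive log-convex comparison sequence `b` with
`b n ≤ C e^{-(c/N) n}` for all `n` and `e^{-c'/N} b n · a (n+1) ≤ b (n+1) · a n` on the dyadic block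
`N/2 ≤ n ≤ N`, when `c' < c`.

Proof (one page, elementary convex analysis; the shape of the "kink lemma" is that of the
subadditive-limit argument, Grimmett 1999, App. II):

* **Kink lemma** (`percAxialLogConvexity_slope_le_of_convex_le_linear`): a convex sequence `g`
  (non-decreasing increments) lying below a line `A - r n` has *every* increment `≤ -r` — an
  increment `d > -r` at `m` propagates to all later increments, so `g (m+j) ≥ g m + j d` eventually
  crosses the line.
* Hence `log b` has all increments `≤ -c/N`, and taking logarithms in the block inequality gives
  `log a (n+1) - log a n ≤ -(c - c')/N` for `N/2 ≤ n ≤ N`; the kink lemma with `A = r = 0` shows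
  `log a` is non-increasing (it is convex and `≤ 0`).
* Summing over the `⌊N/2⌋ + 1 ≥ N/2` increments from `⌈N/2⌉` to `N + 1` loses at least
  `δ := (c - c')/2 > 0`: `log a (N+1) ≤ log a n₀ - δ` whenever `N ≥ 2 n₀ + 1`
  (`percAxialLogConvexity_kink_block_step`).
* Iterating, `log a` drops below `-J δ` for every `J`, contradicting `log θ ≤ log a n`.

Main theorem: `kinkCriterion_proof : KinkCriterion` (the type is literally the route decl).
-/

namespace Summit.CriticalPhenomena.PercolationContinuityZ3.Theorems

/-- **Kink lemma** (route `PercAxialLogConvexity`, helper for `KinkCriterion`).  If `g : ℕ → ℝ` has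
non-decreasing increments (`g (n+1) - g n ≤ g (n+2) - g (n+1)`, i.e. `g` is convex) and lies below the
line `n ↦ A - r n`, then every increment of `g` is at most `-r`.  Indeed an increment `d > -r` at `m`
forces `g (m + j) ≥ g m + j d`, which exceeds `A - r (m + j)` for `j` large (Archimedes). [folklore] -/
theorem percAxialLogConvexity_slope_le_of_convex_le_linear (g : ℕ → ℝ) (A r : ℝ)
    (hconv : ∀ n, g (n + 1) - g n ≤ g (n + 2) - g (n + 1))
    (hbd : ∀ n, g n ≤ A - r * n) : ∀ n, g (n + 1) - g n ≤ -r := by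
  intro m
  by_contra h
  push Not at h
  set d := g (m + 1) - g m with hd
  -- every later increment is at least `d`
  have hslope : ∀ j : ℕ, d ≤ g (m + j + 1) - g (m + j) := by
    intro j
    induction j with
    | zero => simp [hd]
    | succ j ih =>
      have hc := hconv (m + j)
      have h1 : m + (j + 1) + 1 = m + j + 2 := by ring
      have h2 : m + (j + 1) = m + j + 1 := by ring
      rw [h1, h2]
      linarith
  -- hence `g` grows at least linearly with slope `d` after `m`
  have hlin : ∀ j : ℕ, g m + j * d ≤ g (m + j) := by
    intro j
    induction j with
    | zero => simp
    | succ j ih =>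
      have hs := hslope j
      have h2 : m + (j + 1) = m + j + 1 := by ring
      rw [h2]
      push_cast
      linarith
  have hdr : 0 < d + r := by linarith
  obtain ⟨j, hj⟩ := exists_nat_gt ((A - r * m - g m) / (d + r))
  have h1 := hlin j
  have h2 := hbd (m + j)
  push_cast at h2
  rw [div_lt_iff₀ hdr] at hj
  have h3 : (j : ℝ) * (d + r) = j * d + r * j := by ring
  rw [h3] at hj
  linarith

/-- **Log-convexity in additive form** (route `PercAxialLogConvexity`, helper for `KinkCriterion`).
For a positive sequence `u` with `u (n+1)^2 ≤ u n * u (n+2)`, the sequence `log ∘ u` has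
non-decreasing increments. [folklore] -/
theorem percAxialLogConvexity_log_slope_mono (u : ℕ → ℝ) (hpos : ∀ n, 0 < u n)
    (hlc : ∀ n, u (n + 1) ^ 2 ≤ u n * u (n + 2)) :
    ∀ n, Real.log (u (n + 1)) - Real.log (u n) ≤
      Real.log (u (n + 2)) - Real.log (u (n + 1)) := by
  intro n
  have hlog := Real.log_le_log (pow_pos (hpos (n + 1)) 2) (hlc n)
  rw [Real.log_pow, Real.log_mul (hpos n).ne' (hpos (n + 2)).ne'] at hlog
  push_cast at hlog
  linarith

/-- **One block costs `(c - c')/2`** (route `PercAxialLogConvexity`, helper for `KinkCriterion`).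
Let `a` be positive, `≤ 1` and log-convex, let `c' < c`, and let `N ≥ 2 n₀ + 1`, `C`, and a positive
log-convex `b` with `b n ≤ C e^{-(c/N) n}` (all `n`) satisfy the block inequality
`e^{-c'/N} b n · a (n+1) ≤ b (n+1) · a n` for `N/2 ≤ n ≤ N`.  Then
`log a (N+1) ≤ log a n₀ - (c - c')/2`.
Proof: the kink lemma gives `log b (n+1) - log b n ≤ -c/N` for all `n` and `log a` non-increasing;
logs of the block inequality give increments of `log a` at most `-(c-c')/N` on the block, and there
are `⌊N/2⌋ + 1 ≥ N/2` of them between `⌈N/2⌉` and `N + 1`. [folklore] -/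
theorem percAxialLogConvexity_kink_block_step (a b : ℕ → ℝ) (c c' C : ℝ) (n₀ N : ℕ)
    (hcc' : c' < c) (hapos : ∀ n, 0 < a n) (ha1 : ∀ n, a n ≤ 1)
    (halc : ∀ n, a (n + 1) ^ 2 ≤ a n * a (n + 2))
    (hN : 2 * n₀ + 1 ≤ N) (hbpos : ∀ n, 0 < b n)
    (hblc : ∀ n, b (n + 1) ^ 2 ≤ b n * b (n + 2))
    (hbexp : ∀ n : ℕ, b n ≤ C * Real.exp (-(c / N) * n))
    (hblock : ∀ n : ℕ, (N : ℝ) ≤ 2 * n → n ≤ N →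
      Real.exp (-(c' / N)) * (b n * a (n + 1)) ≤ b (n + 1) * a n) :
    Real.log (a (N + 1)) ≤ Real.log (a n₀) - (c - c') / 2 := by
  -- notation
  set f : ℕ → ℝ := fun n => Real.log (a n) with hf
  set g : ℕ → ℝ := fun n => Real.log (b n) with hg
  have hfconv : ∀ n, f (n + 1) - f n ≤ f (n + 2) - f (n + 1) :=
    percAxialLogConvexity_log_slope_mono a hapos halc
  have hgconv : ∀ n, g (n + 1) - g n ≤ g (n + 2) - g (n + 1) :=
    percAxialLogConvexity_log_slope_mono b hbpos hblc
  -- `f` is non-increasing: convex and `≤ 0`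
  have hf0 : ∀ n, f n ≤ 0 - 0 * (n : ℝ) := by
    intro n
    have : f n ≤ 0 := Real.log_nonpos (hapos n).le (ha1 n)
    simpa using this
  have hfdec : ∀ n, f (n + 1) ≤ f n := by
    intro n
    have := percAxialLogConvexity_slope_le_of_convex_le_linear f 0 0 hfconv hf0 n
    linarith
  have hfanti : Antitone f := antitone_nat_of_succ_le hfdec
  -- `C > 0` and the linear upper bound for `g`
  have hN0 : 0 < N := by omega
  have hNpos : (0 : ℝ) < N := by exact_mod_cast hN0
  have hC : 0 < C := by
    have h := lt_of_lt_of_le (hbpos 0) (hbexp 0)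
    exact (mul_pos_iff_of_pos_right (Real.exp_pos _)).mp h
  have hgbd : ∀ n, g n ≤ Real.log C - (c / N) * (n : ℝ) := by
    intro n
    have h1 : Real.log (b n) ≤ Real.log (C * Real.exp (-(c / N) * n)) :=
      Real.log_le_log (hbpos n) (hbexp n)
    rw [Real.log_mul hC.ne' (Real.exp_pos _).ne', Real.log_exp] at h1
    simp only [hg]
    linarith
  -- kink lemma for `g`
  have hgslope : ∀ n, g (n + 1) - g n ≤ -(c / N) :=
    percAxialLogConvexity_slope_le_of_convex_le_linear g (Real.log C) (c / N) hgconv hgbd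
  -- increments of `f` on the block
  have hfblock : ∀ n : ℕ, N ≤ 2 * n → n ≤ N → f (n + 1) - f n ≤ -((c - c') / N) := by
    intro n h2n hnN
    have h2n' : (N : ℝ) ≤ 2 * (n : ℝ) := by exact_mod_cast h2n
    have hb := hblock n h2n' hnN
    have hlhs : 0 < Real.exp (-(c' / N)) * (b n * a (n + 1)) :=
      mul_pos (Real.exp_pos _) (mul_pos (hbpos n) (hapos (n + 1)))
    have hlog := Real.log_le_log hlhs hb
    rw [Real.log_mul (Real.exp_pos _).ne' (mul_pos (hbpos n) (hapos (n + 1))).ne',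
      Real.log_exp, Real.log_mul (hbpos n).ne' (hapos (n + 1)).ne',
      Real.log_mul (hbpos (n + 1)).ne' (hapos n).ne'] at hlog
    have hgs := hgslope n
    simp only [hf, hg] at hgs ⊢
    have : -((c - c') / (N : ℝ)) = -(c / N) + c' / N := by ring
    rw [this]
    linarith
  -- sum over the block from `m₀ := N - N / 2 = ⌈N/2⌉`
  set q : ℕ := N / 2 with hq
  set m₀ : ℕ := N - q with hm₀
  have hm₀n₀ : n₀ ≤ m₀ := by omega
  have hm₀N : N ≤ 2 * m₀ := by omega
  have hm₀top : m₀ + (q + 1) = N + 1 := by omega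
  have hind : ∀ j : ℕ, j ≤ q + 1 → f (m₀ + j) ≤ f m₀ - (j : ℝ) * ((c - c') / N) := by
    intro j
    induction j with
    | zero => intro _; simp
    | succ j ih =>
      intro hj
      have ih' := ih (by omega)
      have hstep := hfblock (m₀ + j) (by omega) (by omega)
      have h2 : m₀ + (j + 1) = m₀ + j + 1 := by ring
      rw [h2]
      push_cast
      linarith
  have htop := hind (q + 1) le_rfl
  rw [hm₀top] at htop
  -- `(q + 1) · (c - c')/N ≥ (c - c')/2`
  have hqN : (N : ℝ) ≤ 2 * (q : ℝ) + 1 := by exact_mod_cast (show N ≤ 2 * q + 1 by omega)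
  have hkey : (c - c') / 2 ≤ ((q + 1 : ℕ) : ℝ) * ((c - c') / N) := by
    rw [mul_div_assoc', div_le_div_iff₀ (by norm_num) hNpos]
    push_cast
    have hcc : 0 ≤ c - c' := by linarith
    have := mul_le_mul_of_nonneg_left hqN hcc
    nlinarith
  have hmono : f m₀ ≤ f n₀ := hfanti hm₀n₀
  simp only [hf] at htop hmono ⊢
  linarith

/-- **Item `stmt-CriticalPhenomena-11551` (`PercAxialLogConvexity.KinkCriterion`), proved.**
Slopes of a log-convex sequence `a` with `0 < θ ≤ a n ≤ 1` cannot be pushed below `-(c - c')/N`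
on dyadic blocks `[N/2, N]` for unboundedly many `N` (`c' < c`): each such block lowers `log a` by
at least `(c - c')/2` (`percAxialLogConvexity_kink_block_step`, using that `log a` is
non-increasing), so iterating drives `log a` below `log θ` — contradiction.  Percolation-free real
analysis; the type is literally the route decl `KinkCriterion`. [folklore] -/
theorem kinkCriterion_proof :
    Summit.CriticalPhenomena.PercolationContinuityZ3.Theses.PercAxialLogConvexity.KinkCriterion := by
  unfold Summit.CriticalPhenomena.PercolationContinuityZ3.Theses.PercAxialLogConvexity.KinkCriterion
  intro a θ c c' hθ hcc' hθa ha1 halc hM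
  have hapos : ∀ n, 0 < a n := fun n => lt_of_lt_of_le hθ (hθa n)
  set δ : ℝ := (c - c') / 2 with hδ
  have hδpos : 0 < δ := by rw [hδ]; linarith
  -- one step: from any `n₀`, some later value of `log a` is lower by `δ`
  have hstep : ∀ n₀ : ℕ, ∃ m : ℕ, Real.log (a m) ≤ Real.log (a n₀) - δ := by
    intro n₀
    obtain ⟨b, N, C, hN, hbpos, hblc, hbexp, hblock⟩ := hM (2 * n₀ + 1)
    exact ⟨N + 1, percAxialLogConvexity_kink_block_step a b c c' C n₀ N hcc' hapos ha1 halc hN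
      hbpos hblc hbexp hblock⟩
  -- iterate
  have hiter : ∀ J : ℕ, ∃ n : ℕ, Real.log (a n) ≤ -(J : ℝ) * δ := by
    intro J
    induction J with
    | zero =>
      refine ⟨0, ?_⟩
      have : Real.log (a 0) ≤ 0 := Real.log_nonpos (hapos 0).le (ha1 0)
      simpa using this
    | succ J ih =>
      obtain ⟨n, hn⟩ := ih
      obtain ⟨m, hm⟩ := hstep n
      refine ⟨m, ?_⟩
      push_cast
      linarith
  -- Archimedes: `J δ > -log θ`
  obtain ⟨J, hJ⟩ := exists_nat_gt (-Real.log θ / δ)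
  obtain ⟨n, hn⟩ := hiter J
  have hlow : Real.log θ ≤ Real.log (a n) := Real.log_le_log hθ (hθa n)
  rw [div_lt_iff₀ hδpos] at hJ
  linarith

end Summit.CriticalPhenomena.PercolationContinuityZ3.Theorems
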